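import Literature.Topology.FourManifolds.BorderedEhresmann
import Literature.Topology.FourManifolds.RegularInterval
import Mathlib.Analysis.Calculus.MeanValue
import HarnessLib

/-!
# Ehresmann's theorem with boundary from given lifts, and level sets preserved by the product structure

Topic `Literature/Topology/FourManifolds` (sequel of `BorderedEhresmann.lean`; fact seat
`provefact-Literature.Geometry.Symplectic.Oba2016_s-add47373d4`: the product structure of a
Lefschetz fibration near its horizontal boundary must preserve the levels of a collar
coordinate of `∂W`).  Everything is proved; no definitions, no named facts.

* §1 `apply_integralCurve_eq_of_mlineDeriv_eq_zero` — **first integrals below a level**: if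
  `dh(V) = 0` at the points of an open `O` where `h < a`, then `h` is constant along an
  integral curve of `V` which stays in `O`, as long as it starts below `a` (continuous
  induction; time reversal `γ ∘ (· * (-1))` for negative times);
* §2 `exists_trivialisation_of_fields` — the product structure `Φ`, `Ψ` of
  `Literature.Topology.FourManifolds.exists_trivialisation_of_box`, built from *given* lifts
  `Xᵢ` of the coordinate fields (smooth, tangent to `∂M`, `dg(Xᵢ) = eᵢ` over the closed
  `Δ`-box), with the additional conclusion that every smooth `h` with `dh(Xᵢ) = 0` over the
  open `Δ`-box below the level `a` is preserved: `h (Φ (u, y)) = h y` and `h (Ψ x) = h x`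
  below `a` (Bröcker–Jänich 1982, proof of (8.12), with the bookkeeping of the first
  integral).

## References

* Th. Bröcker, K. Jänich, *Introduction to Differential Topology*, CUP 1982, (8.12).
  [BrockerJanichIDT1982]
* J. M. Lee, *Introduction to Smooth Manifolds*, 2nd ed., GTM 218 (2012), Thm. 9.34.
  [LeeSmoothManifolds2013]
-/

open scoped Manifold ContDiff Topology
open Set Function Filter

noncomputable section

namespace Literature.Topology.FourManifolds

universe u

/-! ### §1 First integrals below a level -/

section FirstIntegral

variable {E : Type*} [NormedAddCommGroup E] [NormedSpace ℝ E] {H : Type*} [TopologicalSpace H]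
  {I : ModelWithCorners ℝ E H} {M : Type u} [TopologicalSpace M] [ChartedSpace H M]

/-- **First integrals below a level, forward in time.**  Let `h : M → ℝ` be smooth, `O ⊆ M`
open, `dh(V) = 0` at the points of `O` where `h < a`, and `γ` an integral curve of `V` with
`γ([0, T]) ⊆ O` and `h (γ 0) < a`.  Then `h ∘ γ` is constant on `[0, T]` (continuous induction,
`IsClosed.Icc_subset_of_forall_mem_nhdsWithin`, and the mean value inequality). [folklore] -/
theorem apply_integralCurve_eq_of_mlineDeriv_eq_zero_of_nonneg {h : M → ℝ}
    (hh : ContMDiff I 𝓘(ℝ, ℝ) ∞ h) {V : Π x : M, TangentSpace I x} {O : Set M} {a : ℝ}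
    (hV : ∀ x ∈ O, h x < a → mlineDeriv I h x (V x) = 0) {γ : ℝ → M} (hγ : IsMIntegralCurve γ V)
    {T : ℝ} (hγO : ∀ s ∈ Icc 0 T, γ s ∈ O) (h0 : h (γ 0) < a) :
    ∀ s ∈ Icc 0 T, h (γ s) = h (γ 0) := by
  set ψ : ℝ → ℝ := h ∘ γ with hψ
  have hψc : Continuous ψ := hh.continuous.comp hγ.continuous
  have hψd : ∀ t, HasDerivAt ψ (mlineDeriv I h (γ t) (V (γ t))) t :=
    fun t => hasDerivAt_comp_integralCurve hh hγ t
  set S : Set ℝ := {s | ψ s = ψ 0} with hS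
  have hSc : IsClosed (S ∩ Icc 0 T) := (isClosed_eq hψc continuous_const).inter isClosed_Icc
  have h0S : (0 : ℝ) ∈ S := rfl
  have key : Icc 0 T ⊆ S := by
    refine hSc.Icc_subset_of_forall_mem_nhdsWithin h0S fun x hx => ?_
    obtain ⟨hxS, hx0, hxT⟩ := hx
    have hxa : ψ x < a := by rw [show ψ x = ψ 0 from hxS]; exact h0
    -- `ψ < a` on a right neighbourhood of `x`
    have hev : ∀ᶠ r in 𝓝 x, ψ r < a := hψc.continuousAt.eventually_lt continuousAt_const hxa
    obtain ⟨ε, hε, hεa⟩ := Metric.eventually_nhds_iff.1 hev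
    set ε' := min (ε / 2) (T - x) with hε'
    have hε'pos : 0 < ε' := lt_min (by positivity) (by linarith)
    have hε'T : x + ε' ≤ T := by
      have := min_le_right (ε / 2) (T - x); rw [← hε'] at this; linarith
    -- `ψ' = 0` on `[x, x + ε']`
    have hderiv0 : ∀ r ∈ Icc x (x + ε'), mlineDeriv I h (γ r) (V (γ r)) = 0 := by
      intro r hr
      have hrO : γ r ∈ O := hγO r ⟨hx0.trans hr.1, hr.2.trans hε'T⟩
      have hra : ψ r < a := by
        refine hεa ?_
        rw [Real.dist_eq]
        have h1 := min_le_left (ε / 2) (T - x)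
        rw [← hε'] at h1
        rw [abs_lt]; constructor <;> linarith [hr.1, hr.2]
      exact hV (γ r) hrO hra
    have hconst : ∀ r ∈ Icc x (x + ε'), ψ r = ψ x := by
      intro r hr
      have h := norm_image_sub_le_of_norm_deriv_le_segment' (f := ψ) (C := 0)
        (fun t ht => (hψd t).hasDerivWithinAt) (fun t ht => by
          rw [hderiv0 t ⟨ht.1, ht.2.le⟩, norm_zero]) r hr
      rw [zero_mul, norm_le_zero_iff, sub_eq_zero] at h
      exact h
    have hsub : Ioo x (x + ε') ⊆ S := fun r hr => by
      show ψ r = ψ 0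
      rw [hconst r ⟨hr.1.le, hr.2.le⟩]; exact hxS
    exact mem_of_superset (Ioo_mem_nhdsGT (by linarith)) hsub
  intro s hs
  exact key hs

/-- **First integrals below a level**, both time directions: if `dh(V) = 0` at the points of
the open `O` where `h < a`, an integral curve `γ` of `V` with `γ(uIcc 0 t) ⊆ O` and
`h (γ 0) < a` has `h (γ t) = h (γ 0)`. [folklore] -/
theorem apply_integralCurve_eq_of_mlineDeriv_eq_zero {h : M → ℝ}
    (hh : ContMDiff I 𝓘(ℝ, ℝ) ∞ h) {V : Π x : M, TangentSpace I x} {O : Set M} {a : ℝ}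
    (hV : ∀ x ∈ O, h x < a → mlineDeriv I h x (V x) = 0) {γ : ℝ → M} (hγ : IsMIntegralCurve γ V)
    {t : ℝ} (hγO : ∀ s ∈ uIcc 0 t, γ s ∈ O) (h0 : h (γ 0) < a) :
    h (γ t) = h (γ 0) := by
  rcases le_total 0 t with ht | ht
  · rw [uIcc_of_le ht] at hγO
    exact apply_integralCurve_eq_of_mlineDeriv_eq_zero_of_nonneg hh hV hγ hγO h0 t
      (right_mem_Icc.2 ht)
  · rw [uIcc_of_ge ht] at hγO
    -- time reversal
    have hγ' : IsMIntegralCurve (γ ∘ (· * (-1 : ℝ))) ((-1 : ℝ) • V) := hγ.comp_mul (-1)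
    have hV' : ∀ x ∈ O, h x < a → mlineDeriv I h x (((-1 : ℝ) • V) x) = 0 := by
      intro x hx hxa
      rw [Pi.smul_apply, mlineDeriv_smul, hV x hx hxa, mul_zero]
    have hγO' : ∀ s ∈ Icc 0 (-t), (γ ∘ (· * (-1 : ℝ))) s ∈ O := by
      intro s hs
      refine hγO _ ⟨?_, ?_⟩
      · show t ≤ s * (-1); linarith [hs.2]
      · show s * (-1) ≤ 0; linarith [hs.1]
    have h0' : h ((γ ∘ (· * (-1 : ℝ))) 0) < a := by simpa using h0
    have h := apply_integralCurve_eq_of_mlineDeriv_eq_zero_of_nonneg hh hV' hγ' hγO' h0'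
      (-t) (right_mem_Icc.2 (by linarith))
    simpa using h

end FirstIntegral

/-! ### §2 The product structure from given lifts, preserving first integrals -/

section Product

variable {k m : ℕ} {M : Type u} [TopologicalSpace M] [ChartedSpace (EuclideanHalfSpace (k + 1)) M]
  [IsManifold (𝓡∂ (k + 1)) ∞ M] [T2Space M] [CompactSpace M]

/-- **Ehresmann's theorem with boundary over a box, from given lifts, with first integrals.**
Let `M` be a compact Hausdorff manifold with boundary, `g : M → ℝᵐ` smooth, `c₀ ∈ ℝᵐ`,
`δ ≤ Δ`, and `X₀, …, X_{m-1}` smooth vector fields tangent to `∂M` with `dg(Xᵢ) = eᵢ` over the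
closed `Δ`-box `{x | ∀ i, |g x i - c₀ i| ≤ Δ}`.  Then the folds `Φ`, `Ψ` of their flows have all
the properties of `Literature.Topology.FourManifolds.exists_trivialisation_of_box` (`Φ (c₀, y) = y`; `g (Φ (u, y)) = u`,
`Ψ (Φ (u, y)) = y` for `g y = c₀`, `u` in the open `δ`-box `Q`; `g (Ψ x) = c₀`,
`Φ (g x, Ψ x) = x` for `g x ∈ Q`; boundary iff boundary), and moreover **every smooth first
integral `h` of the `Xᵢ` over the open `Δ`-box below a level `a`** (`dh(Xᵢ) = 0` wherever
`g x` lies in the open `Δ`-box and `h x < a`) **is preserved**: `h (Φ (u, y)) = h y` for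
`g y = c₀`, `h y < a`, `u ∈ Q`, and `h (Ψ x) = h x` for `g x ∈ Q`, `h x < a`.
[cite: BrockerJanichIDT1982, (8.12) (proof)] [cite: LeeSmoothManifolds2013, Thm. 9.34] -/
theorem exists_trivialisation_of_fields {g : M → EuclideanSpace ℝ (Fin m)}
    (hg : ContMDiff (𝓡∂ (k + 1)) 𝓘(ℝ, EuclideanSpace ℝ (Fin m)) ∞ g)
    {c₀ : EuclideanSpace ℝ (Fin m)} {δ Δ : ℝ} (hδΔ : δ ≤ Δ)
    {X : Fin m → Π x : M, TangentSpace (𝓡∂ (k + 1)) x}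
    (hXs : ∀ i, ContMDiff (𝓡∂ (k + 1)) (𝓡∂ (k + 1)).tangent ∞
      (fun x => (⟨x, X i x⟩ : TangentBundle (𝓡∂ (k + 1)) M)))
    (hXt : ∀ i, ∀ z ∈ (𝓡∂ (k + 1)).boundary M, halfSpaceCoord k (X i z) = 0)
    (hXg : ∀ i x, (∀ j, |g x j - c₀ j| ≤ Δ) →
      mfderiv (𝓡∂ (k + 1)) 𝓘(ℝ, EuclideanSpace ℝ (Fin m)) g x (X i x) = EuclideanSpace.single i (1 : ℝ)) :
    ∃ (Φ : EuclideanSpace ℝ (Fin m) × M → M) (Ψ : M → M),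
      ContMDiff (𝓘(ℝ, EuclideanSpace ℝ (Fin m)).prod (𝓡∂ (k + 1))) (𝓡∂ (k + 1)) ∞ Φ ∧
      ContMDiff (𝓡∂ (k + 1)) (𝓡∂ (k + 1)) ∞ Ψ ∧
      (∀ y, Φ (c₀, y) = y) ∧
      (∀ y, g y = c₀ → ∀ u : EuclideanSpace ℝ (Fin m), (∀ i, |u i - c₀ i| < δ) →
        g (Φ (u, y)) = u ∧ Ψ (Φ (u, y)) = y) ∧
      (∀ x, (∀ i, |g x i - c₀ i| < δ) → g (Ψ x) = c₀ ∧ Φ (g x, Ψ x) = x) ∧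
      (∀ u y, Φ (u, y) ∈ (𝓡∂ (k + 1)).boundary M ↔ y ∈ (𝓡∂ (k + 1)).boundary M) ∧
      (∀ x, Ψ x ∈ (𝓡∂ (k + 1)).boundary M ↔ x ∈ (𝓡∂ (k + 1)).boundary M) ∧
      ∀ (h : M → ℝ), ContMDiff (𝓡∂ (k + 1)) 𝓘(ℝ, ℝ) ∞ h → ∀ a : ℝ,
        (∀ i x, (∀ j, |g x j - c₀ j| < Δ) → h x < a → mlineDeriv (𝓡∂ (k + 1)) h x (X i x) = 0) →
        (∀ y, g y = c₀ → h y < a → ∀ u : EuclideanSpace ℝ (Fin m), (∀ i, |u i - c₀ i| < δ) →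
          h (Φ (u, y)) = h y) ∧
        ∀ x, (∀ i, |g x i - c₀ i| < δ) → h x < a → h (Ψ x) = h x := by
  set C : Set M := {x | ∀ i, |g x i - c₀ i| ≤ Δ} with hC
  set Qb : Set (EuclideanSpace ℝ (Fin m)) := {w | ∀ j, |w j - c₀ j| < Δ} with hQb
  have hQbo : IsOpen Qb := isOpen_setOf_forall_abs_sub_lt c₀ Δ
  have hQbC : g ⁻¹' Qb ⊆ C := fun x hx j => (hx j).le
  -- the flows and their translating property
  choose θ hθ _ using fun i => exists_isSmoothFlow_of_tangent (hXs i) (hXt i)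
  have hθg : ∀ (i : Fin m) (p : M) (t : ℝ),
      (∀ s ∈ uIcc 0 t, ∀ j, |(g p + s • EuclideanSpace.single i (1 : ℝ)) j - c₀ j| < Δ) →
        g (θ i (t, p)) = g p + t • EuclideanSpace.single i (1 : ℝ) := by
    intro i p t hseg
    have hγ : IsMIntegralCurve (fun t => θ i (t, p)) (X i) := (hθ i).isMIntegralCurve p
    have h0 : θ i (0, p) = p := (hθ i).map_zero p
    have hseg' : ∀ s ∈ uIcc 0 t, g (θ i (0, p)) + s • EuclideanSpace.single i (1 : ℝ) ∈ Qb := by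
      intro s hs; rw [h0]; exact hseg s hs
    have h := Literature.Geometry.Manifold.apply_integralCurve_eq_add_smul_of_segment
      (hg.of_le (by norm_cast)) (fun x hx => hXg i x hx) hQbo hQbC hγ hseg' (s := t) right_mem_uIcc
    rw [h0] at h
    exact h
  have hθb : ∀ i t p, θ i (t, p) ∈ (𝓡∂ (k + 1)).boundary M ↔ p ∈ (𝓡∂ (k + 1)).boundary M :=
    fun i t p => (hθ i).mem_boundary_iff_of_tangent (hXs i) (hXt i) t p
  have h0 : ∀ i p, θ i (0, p) = p := fun i p => (hθ i).map_zero p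
  have hadd : ∀ i t s p, θ i (t, θ i (s, p)) = θ i (t + s, p) := fun i => (hθ i).map_add
  -- first integrals along one flow inside the open box
  have hlev1 : ∀ (h : M → ℝ), ContMDiff (𝓡∂ (k + 1)) 𝓘(ℝ, ℝ) ∞ h → ∀ a : ℝ,
      (∀ i x, (∀ j, |g x j - c₀ j| < Δ) → h x < a → mlineDeriv (𝓡∂ (k + 1)) h x (X i x) = 0) →
      ∀ (i : Fin m) (p : M) (t : ℝ),
        (∀ s ∈ uIcc 0 t, ∀ j, |(g p + s • EuclideanSpace.single i (1 : ℝ)) j - c₀ j| < Δ) →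
        h p < a → h (θ i (t, p)) = h p := by
    intro h hh a hlev i p t hseg hpa
    have hγ : IsMIntegralCurve (fun t => θ i (t, p)) (X i) := (hθ i).isMIntegralCurve p
    have hγO : ∀ s ∈ uIcc 0 t, θ i (s, p) ∈ g ⁻¹' Qb := by
      intro s hs
      show g (θ i (s, p)) ∈ Qb
      rw [hθg i p s fun s' hs' => hseg s' (uIcc_subset_uIcc_left hs hs')]
      exact hseg s hs
    have h := apply_integralCurve_eq_of_mlineDeriv_eq_zero (O := g ⁻¹' Qb) hh
      (fun x hx hxa => hlev i x hx hxa) hγ hγO (by rw [h0]; exact hpa)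
    rw [h0] at h
    exact h
  -- first integrals along a fold
  have hlevfold : ∀ (h : M → ℝ), ContMDiff (𝓡∂ (k + 1)) 𝓘(ℝ, ℝ) ∞ h → ∀ a : ℝ,
      (∀ i x, (∀ j, |g x j - c₀ j| < Δ) → h x < a → mlineDeriv (𝓡∂ (k + 1)) h x (X i x) = 0) →
      ∀ {u v : EuclideanSpace ℝ (Fin m)}, (∀ j, |u j - c₀ j| < δ) → (∀ j, |v j - c₀ j| < δ) →
      ∀ (l : List (Fin m)), l.Nodup → ∀ {y : M}, g y = v → h y < a →
        h (l.foldr (fun i acc => θ i (u i - v i, acc)) y) = h y := by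
    intro h hh a hlev u v hu hv l hl y hy hya
    induction l with
    | nil => rfl
    | cons i l ih =>
      have hil : i ∉ l := (List.nodup_cons.1 hl).1
      have hl' : l.Nodup := (List.nodup_cons.1 hl).2
      set z := l.foldr (fun i acc => θ i (u i - v i, acc)) y with hz
      have hzh : h z = h y := ih hl'
      have hzc : ∀ j, g z j = if j ∈ l then u j else v j := fun j =>
        apply_foldr_translating_coord hδΔ hθg hu hv l hl' hy j
      have hzbox : ∀ j, |g z j - c₀ j| < δ := fun j => by
        rw [hzc j]; split_ifs
        · exact hu j
        · exact hv j
      have hzi : g z i = v i := by rw [hzc i, if_neg hil]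
      have hseg : ∀ s ∈ uIcc 0 (u i - v i), ∀ j,
          |(g z + s • EuclideanSpace.single i (1 : ℝ)) j - c₀ j| < Δ := fun s hs =>
        add_smul_single_mem_box hδΔ hzbox i (hu i) (by rw [hzi]; exact hs)
      rw [List.foldr_cons, hlev1 h hh a hlev i z (u i - v i) hseg (by rw [hzh]; exact hya), hzh]
  -- the folds
  set Φ : EuclideanSpace ℝ (Fin m) × M → M := fun q =>
    (List.finRange m).foldr (fun i acc => θ i (q.1 i - c₀ i, acc)) q.2 with hΦ
  set Ψ : M → M := fun x =>
    (List.finRange m).foldl (fun acc i => θ i (-(g x i - c₀ i), acc)) x with hΨ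
  have hΨ' : ∀ x, Ψ x = (List.finRange m).reverse.foldr (fun i acc => θ i (c₀ i - g x i, acc)) x := by
    intro x
    simp only [hΨ, List.foldl_eq_foldr_reverse, neg_sub]
  have hδbox : ∀ {w : EuclideanSpace ℝ (Fin m)}, (∀ i, |w i - c₀ i| < δ) → ∀ i, |c₀ i - c₀ i| < δ :=
    fun hw i => by rw [sub_self, abs_zero]; exact lt_of_le_of_lt (abs_nonneg _) (hw i)
  refine ⟨Φ, Ψ, ?_, ?_, fun y => ?_, fun y hy u hu => ?_, fun x hx => ?_, fun u y => ?_, fun x => ?_,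
    fun h hh a hlev => ⟨fun y hy hya u hu => ?_, fun x hx hxa => ?_⟩⟩
  · -- smoothness of `Φ`
    exact contMDiff_foldr_flow (IP := 𝓘(ℝ, EuclideanSpace ℝ (Fin m))) (fun i => (hθ i).contMDiff)
      (fun i => ((EuclideanSpace.proj i).contMDiff).sub contMDiff_const) (List.finRange m)
  · -- smoothness of `Ψ`
    have h1 : ContMDiff ((𝓡∂ (k + 1)).prod (𝓡∂ (k + 1))) (𝓡∂ (k + 1)) ∞
        fun q : M × M => (List.finRange m).reverse.foldr
          (fun i acc => θ i (c₀ i - g q.1 i, acc)) q.2 :=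
      contMDiff_foldr_flow (IP := 𝓡∂ (k + 1)) (fun i => (hθ i).contMDiff)
        (fun i => contMDiff_const.sub (((EuclideanSpace.proj i).contMDiff).comp hg))
        (List.finRange m).reverse
    have h2 : ContMDiff (𝓡∂ (k + 1)) (𝓡∂ (k + 1)) ∞ fun x =>
        (List.finRange m).reverse.foldr (fun i acc => θ i (c₀ i - g x i, acc)) x :=
      h1.comp (contMDiff_id.prodMk contMDiff_id)
    exact h2.congr fun x => (hΨ' x)
  · -- `Φ (c₀, y) = y`
    show (List.finRange m).foldr (fun i acc => θ i (c₀ i - c₀ i, acc)) y = y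
    simp only [sub_self]
    exact foldr_flow_zero h0 _ y
  · -- over the fibre of `c₀`
    have hgΦ : g (Φ (u, y)) = u := by
      ext j
      have h := apply_foldr_translating_coord hδΔ hθg hu (hδbox hu) (List.finRange m)
        (List.nodup_finRange m) hy j
      rw [if_pos (List.mem_finRange j)] at h
      exact h
    refine ⟨hgΦ, ?_⟩
    show (List.finRange m).foldl (fun acc i => θ i (-(g (Φ (u, y)) i - c₀ i), acc)) (Φ (u, y)) = y
    rw [hgΦ]
    exact Literature.Geometry.Manifold.foldl_foldr_flow h0 hadd (fun i => u i - c₀ i) (List.finRange m) y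
  · -- over the box
    have hgΨ : g (Ψ x) = c₀ := by
      ext j
      rw [hΨ']
      have h := apply_foldr_translating_coord hδΔ hθg (hδbox hx) hx (List.finRange m).reverse
        (List.nodup_reverse.2 (List.nodup_finRange m)) rfl j
      rw [if_pos (List.mem_reverse.2 (List.mem_finRange j))] at h
      exact h
    refine ⟨hgΨ, ?_⟩
    show (List.finRange m).foldr (fun i acc => θ i (g x i - c₀ i, acc))
      ((List.finRange m).foldl (fun acc i => θ i (-(g x i - c₀ i), acc)) x) = x
    exact Literature.Geometry.Manifold.foldr_foldl_flow h0 hadd (fun i => g x i - c₀ i) (List.finRange m) x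
  · exact foldr_flow_mem_boundary_iff hθb (fun i => u i - c₀ i) (List.finRange m) y
  · rw [hΨ']
    exact foldr_flow_mem_boundary_iff hθb (fun i => c₀ i - g x i) (List.finRange m).reverse x
  · -- first integrals along `Φ`
    exact hlevfold h hh a hlev hu (hδbox hu) (List.finRange m) (List.nodup_finRange m) hy hya
  · -- first integrals along `Ψ`
    rw [hΨ']
    exact hlevfold h hh a hlev (hδbox hx) hx (List.finRange m).reverse
      (List.nodup_reverse.2 (List.nodup_finRange m)) rfl hxa

end Product

end Literature.Topology.FourManifolds

end
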